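import Mathlib
import Summits.Ventures.PercRepro2.Defs
import Summits.Ventures.PercRepro2.Independence
import Summits.Ventures.PercRepro2.Harris
import Summits.Ventures.PercRepro2.Graph
import Summits.Ventures.PercRepro2.Exploration
import Summits.Ventures.PercRepro2.Events
import Summits.Ventures.PercRepro2.Induced
import Summits.Ventures.PercRepro2.BHK
import Summits.Ventures.PercRepro2.BHKEvents
import Summits.Ventures.PercRepro2.OneEdge
import Summits.Ventures.PercRepro2.RBRoot
import Summits.Ventures.PercRepro2.RBRootEdge
import Summits.Ventures.PercRepro2.RBRootEdgePin
import Summits.Ventures.PercRepro2.RBRootEdgeMain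
import Summits.Ventures.PercRepro2.RBRootIsolated
import Summits.Ventures.PercRepro2.RBTwoMarkers

/-!
# Row 2′RB at a third vertex adjacent only to the two markers — cross form, I (mine-a g5; §32)

Ingredients for `cross_two_markers` (in `RBTwoMarkersCrossMain.lean`): the marker-edge affinity
of the Rao–Blackwell sum for the cross pair `({b ↔ s}, {o ↔ t})` in the weight of `{w, b}`
(`rbSum_pin_cross_b`) and of `{w, o}` (`rbSum_pin_cross_o`), the collapses at the pinned marker,
(`rbSum_update_one_cross_b/_o`); and, in `CrossAux`, the two-edge forcing identities
`prob_both_open_eq` (`P₁₁(S) = P₀₀(S⁺⁺)`), `prob_both_closed_eq` (the `G − w` law is supported on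
both edges closed) and the cleared mixture inequality `mix_cross_var`: with `0 ≤ A, D ≤ Z`,
`P₁ Z ≤ A D`, `A − P₁ ≤ M ≤ Z₁ ≤ Z − P₁`, `D − P₁ ≤ M′`,
`(1 − x)·AD/Z ≤ (xM + (1−x)A)(xM′ + (1−x)D)/(xZ₁ + (1−x)Z)` for `x ∈ [0, 1]`.
-/

namespace Summit.Ventures.PercRepro2

namespace RBTwoMarkers

open scoped Classical

section CrossAffine

variable {V : Type*} {E : Type*} [Fintype E] [DecidableEq E] [Fintype V] {R : Type*} [Field R]
  [LinearOrder R] [IsStrictOrderedRing R] (ends : E → Sym2 V) (s t w : V) {e : E}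

omit [LinearOrder R] [IsStrictOrderedRing R] in
/-- The residual factor of `{o ↔ t}` does not depend on the weight of an edge touching `A`. -/
lemma kappa_update_of_mem_touches {p : E → R} {A : Set V} (he : e ∈ touches ends A) (o : V) (c : R) :
    prob (Function.update p e c) {ω | Conn ends (restrict (touches ends A)ᶜ ω) o t} =
      prob p {ω | Conn ends (restrict (touches ends A)ᶜ ω) o t} := by
  rw [prob_eq_pin p _ e, RBRootEdge.prob_update_one_of_dependsOn p ends he
    (dependsOn_restrict (touches ends A)ᶜ fun ω' => Conn ends ω' o t),
    RBRootEdge.prob_update_zero_of_dependsOn p ends he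
    (dependsOn_restrict (touches ends A)ᶜ fun ω' => Conn ends ω' o t)]
  have := prob_eq_pin (Function.update p e c) {ω | Conn ends (restrict (touches ends A)ᶜ ω) o t} e
  rw [Function.update_idem, Function.update_idem, Function.update_self,
    RBRootEdge.prob_update_one_of_dependsOn p ends he
    (dependsOn_restrict (touches ends A)ᶜ fun ω' => Conn ends ω' o t),
    RBRootEdge.prob_update_zero_of_dependsOn p ends he
    (dependsOn_restrict (touches ends A)ᶜ fun ω' => Conn ends ω' o t)] at this
  rw [this]
  ring

/-- **Affinity of the atom term, cross pair, in the weight of `e = {w, b}`.** -/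
lemma term_pin_cross_b {p : E → R} (hp : IsProbVec p) {b : V} (hends : ends e = s(w, b))
    (o : V) (A : Set V) :
    prob p ((connEvent ends s t)ᶜ ∩ clusterEvent ends w A ∩ connEvent ends b s) *
        prob p ((connEvent ends s t)ᶜ ∩ clusterEvent ends w A ∩ connEvent ends o t) /
      prob p ((connEvent ends s t)ᶜ ∩ clusterEvent ends w A) =
    p e * (prob (Function.update p e 1) ((connEvent ends s t)ᶜ ∩ clusterEvent ends w A ∩
            connEvent ends b s) *
          prob (Function.update p e 1) ((connEvent ends s t)ᶜ ∩ clusterEvent ends w A ∩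
            connEvent ends o t) /
        prob (Function.update p e 1) ((connEvent ends s t)ᶜ ∩ clusterEvent ends w A)) +
      (1 - p e) * (prob (Function.update p e 0) ((connEvent ends s t)ᶜ ∩ clusterEvent ends w A ∩
            connEvent ends b s) *
          prob (Function.update p e 0) ((connEvent ends s t)ᶜ ∩ clusterEvent ends w A ∩
            connEvent ends o t) /
        prob (Function.update p e 0) ((connEvent ends s t)ᶜ ∩ clusterEvent ends w A)) := by
  by_cases hb : b ∈ A
  · by_cases hs : s ∈ A
    · by_cases ht : t ∈ A
      · rw [RBRootEdge.compl_inter_atom_of_mem_mem ends s t w hs ht]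
        simp
      · rw [RBRootEdge.compl_inter_atom_of_mem_notMem ends s t w hs ht]
        have he : e ∈ touches ends A := RBRootEdge.mem_touches_of_mem ends b w hends hb
        have h1 := RBRootEdge.prob_atom_inter_conn_other (Function.update p e 1) ends t w ht o
        have h0 := RBRootEdge.prob_atom_inter_conn_other (Function.update p e 0) ends t w ht o
        rw [kappa_update_of_mem_touches ends t he o 1] at h1
        rw [kappa_update_of_mem_touches ends t he o 0] at h0
        exact RBRootEdge.affine_of_factor (prob_eq_pin p _ e)
          (RBRootEdge.prob_atom_inter_conn_root p ends s w hs b)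
          (RBRootEdge.prob_atom_inter_conn_root _ ends s w hs b)
          (RBRootEdge.prob_atom_inter_conn_root _ ends s w hs b)
          (RBRootEdge.prob_atom_inter_conn_other p ends t w ht o) h0 h1
    · have h0 : ∀ q : E → R, prob q ((connEvent ends s t)ᶜ ∩ clusterEvent ends w A ∩
          connEvent ends b s) = 0 := by
        intro q
        rw [Set.inter_assoc, connEvent_comm ends s b,
          RBRootEdge.atom_inter_connEvent_of_notMem ends b w hb hs, Set.inter_empty, prob_empty]
      rw [h0, h0, h0]
      simp
  · have hp0 : IsProbVec (Function.update p e 0) := hp.update e le_rfl zero_le_one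
    rw [Set.inter_right_comm _ _ (connEvent ends b s), Set.inter_right_comm _ _ (connEvent ends o t)]
    set d0 := prob (Function.update p e 0) ((connEvent ends s t)ᶜ ∩ clusterEvent ends w A) with hd0
    set a0 := prob (Function.update p e 0) ((connEvent ends s t)ᶜ ∩ connEvent ends b s ∩
      clusterEvent ends w A) with ha0
    set b0 := prob (Function.update p e 0) ((connEvent ends s t)ᶜ ∩ connEvent ends o t ∩
      clusterEvent ends w A) with hb0
    have ha0' : a0 = d0 * (a0 / d0) := by
      by_cases h : d0 = 0
      · have hle : a0 ≤ d0 := prob_mono hp0 fun ω hω => ⟨hω.1.1, hω.2⟩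
        rw [h] at hle
        rw [le_antisymm hle (prob_nonneg hp0 _), h]
        simp
      · rw [mul_div_cancel₀ _ h]
    have hb0' : b0 = d0 * (b0 / d0) := by
      by_cases h : d0 = 0
      · have hle : b0 ≤ d0 := prob_mono hp0 fun ω hω => ⟨hω.1.1, hω.2⟩
        rw [h] at hle
        rw [le_antisymm hle (prob_nonneg hp0 _), h]
        simp
      · rw [mul_div_cancel₀ _ h]
    refine RBRootEdge.affine_of_factor (c₁ := a0 / d0) (c₂ := b0 / d0) (prob_eq_pin p _ e) ?_ ha0'
      ?_ ?_ hb0' ?_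
    · rw [RBRootEdge.prob_atom_of_notMem p ends b w hends hb ((connEvent ends s t)ᶜ ∩ connEvent ends b s),
        RBRootEdge.prob_atom_of_notMem p ends b w hends hb (connEvent ends s t)ᶜ, ← ha0, ← hd0,
        mul_assoc, ← ha0']
    · rw [RBRootEdge.prob_update_one_atom_of_notMem p ends b w hends hb
        ((connEvent ends s t)ᶜ ∩ connEvent ends b s),
        RBRootEdge.prob_update_one_atom_of_notMem p ends b w hends hb (connEvent ends s t)ᶜ, zero_mul]
    · rw [RBRootEdge.prob_atom_of_notMem p ends b w hends hb ((connEvent ends s t)ᶜ ∩ connEvent ends o t),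
        RBRootEdge.prob_atom_of_notMem p ends b w hends hb (connEvent ends s t)ᶜ, ← hb0, ← hd0,
        mul_assoc, ← hb0']
    · rw [RBRootEdge.prob_update_one_atom_of_notMem p ends b w hends hb
        ((connEvent ends s t)ᶜ ∩ connEvent ends o t),
        RBRootEdge.prob_update_one_atom_of_notMem p ends b w hends hb (connEvent ends s t)ᶜ, zero_mul]

/-- **Affinity of the atom term, cross pair, in the weight of `e = {w, o}`.** -/
lemma term_pin_cross_o {p : E → R} (hp : IsProbVec p) {o : V} (hends : ends e = s(w, o))
    (b : V) (A : Set V) :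
    prob p ((connEvent ends s t)ᶜ ∩ clusterEvent ends w A ∩ connEvent ends b s) *
        prob p ((connEvent ends s t)ᶜ ∩ clusterEvent ends w A ∩ connEvent ends o t) /
      prob p ((connEvent ends s t)ᶜ ∩ clusterEvent ends w A) =
    p e * (prob (Function.update p e 1) ((connEvent ends s t)ᶜ ∩ clusterEvent ends w A ∩
            connEvent ends b s) *
          prob (Function.update p e 1) ((connEvent ends s t)ᶜ ∩ clusterEvent ends w A ∩
            connEvent ends o t) /
        prob (Function.update p e 1) ((connEvent ends s t)ᶜ ∩ clusterEvent ends w A)) +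
      (1 - p e) * (prob (Function.update p e 0) ((connEvent ends s t)ᶜ ∩ clusterEvent ends w A ∩
            connEvent ends b s) *
          prob (Function.update p e 0) ((connEvent ends s t)ᶜ ∩ clusterEvent ends w A ∩
            connEvent ends o t) /
        prob (Function.update p e 0) ((connEvent ends s t)ᶜ ∩ clusterEvent ends w A)) := by
  by_cases ho : o ∈ A
  · by_cases ht : t ∈ A
    · by_cases hs : s ∈ A
      · rw [RBRootEdge.compl_inter_atom_of_mem_mem ends s t w hs ht]
        simp
      · rw [RBRoot.compl_connEvent_comm, RBRootEdge.compl_inter_atom_of_mem_notMem ends t s w ht hs]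
        have he : e ∈ touches ends A := RBRootEdge.mem_touches_of_mem ends o w hends ho
        have h1 := RBRootEdge.prob_atom_inter_conn_other (Function.update p e 1) ends s w hs b
        have h0 := RBRootEdge.prob_atom_inter_conn_other (Function.update p e 0) ends s w hs b
        rw [kappa_update_of_mem_touches ends s he b 1] at h1
        rw [kappa_update_of_mem_touches ends s he b 0] at h0
        exact RBRootEdge.affine_of_factor (prob_eq_pin p _ e)
          (RBRootEdge.prob_atom_inter_conn_other p ends s w hs b) h0 h1
          (RBRootEdge.prob_atom_inter_conn_root p ends t w ht o)
          (RBRootEdge.prob_atom_inter_conn_root _ ends t w ht o)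
          (RBRootEdge.prob_atom_inter_conn_root _ ends t w ht o)
    · have h0 : ∀ q : E → R, prob q ((connEvent ends s t)ᶜ ∩ clusterEvent ends w A ∩
          connEvent ends o t) = 0 := by
        intro q
        rw [Set.inter_assoc, connEvent_comm ends t o,
          RBRootEdge.atom_inter_connEvent_of_notMem ends o w ho ht, Set.inter_empty, prob_empty]
      rw [h0, h0, h0]
      simp
  · have hp0 : IsProbVec (Function.update p e 0) := hp.update e le_rfl zero_le_one
    rw [Set.inter_right_comm _ _ (connEvent ends b s), Set.inter_right_comm _ _ (connEvent ends o t)]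
    set d0 := prob (Function.update p e 0) ((connEvent ends s t)ᶜ ∩ clusterEvent ends w A) with hd0
    set a0 := prob (Function.update p e 0) ((connEvent ends s t)ᶜ ∩ connEvent ends b s ∩
      clusterEvent ends w A) with ha0
    set b0 := prob (Function.update p e 0) ((connEvent ends s t)ᶜ ∩ connEvent ends o t ∩
      clusterEvent ends w A) with hb0
    have ha0' : a0 = d0 * (a0 / d0) := by
      by_cases h : d0 = 0
      · have hle : a0 ≤ d0 := prob_mono hp0 fun ω hω => ⟨hω.1.1, hω.2⟩
        rw [h] at hle
        rw [le_antisymm hle (prob_nonneg hp0 _), h]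
        simp
      · rw [mul_div_cancel₀ _ h]
    have hb0' : b0 = d0 * (b0 / d0) := by
      by_cases h : d0 = 0
      · have hle : b0 ≤ d0 := prob_mono hp0 fun ω hω => ⟨hω.1.1, hω.2⟩
        rw [h] at hle
        rw [le_antisymm hle (prob_nonneg hp0 _), h]
        simp
      · rw [mul_div_cancel₀ _ h]
    refine RBRootEdge.affine_of_factor (c₁ := a0 / d0) (c₂ := b0 / d0) (prob_eq_pin p _ e) ?_ ha0'
      ?_ ?_ hb0' ?_
    · rw [RBRootEdge.prob_atom_of_notMem p ends o w hends ho ((connEvent ends s t)ᶜ ∩ connEvent ends b s),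
        RBRootEdge.prob_atom_of_notMem p ends o w hends ho (connEvent ends s t)ᶜ, ← ha0, ← hd0,
        mul_assoc, ← ha0']
    · rw [RBRootEdge.prob_update_one_atom_of_notMem p ends o w hends ho
        ((connEvent ends s t)ᶜ ∩ connEvent ends b s),
        RBRootEdge.prob_update_one_atom_of_notMem p ends o w hends ho (connEvent ends s t)ᶜ, zero_mul]
    · rw [RBRootEdge.prob_atom_of_notMem p ends o w hends ho ((connEvent ends s t)ᶜ ∩ connEvent ends o t),
        RBRootEdge.prob_atom_of_notMem p ends o w hends ho (connEvent ends s t)ᶜ, ← hb0, ← hd0,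
        mul_assoc, ← hb0']
    · rw [RBRootEdge.prob_update_one_atom_of_notMem p ends o w hends ho
        ((connEvent ends s t)ᶜ ∩ connEvent ends o t),
        RBRootEdge.prob_update_one_atom_of_notMem p ends o w hends ho (connEvent ends s t)ᶜ, zero_mul]

/-- **Affinity of the Rao–Blackwell sum, cross pair, in the weight of `{w, b}`.** -/
theorem rbSum_pin_cross_b {p : E → R} (hp : IsProbVec p) {b : V} (hends : ends e = s(w, b)) (o : V) :
    RBRoot.rbSum p ends s t w (connEvent ends b s) (connEvent ends o t) =
      p e * RBRoot.rbSum (Function.update p e 1) ends s t w (connEvent ends b s) (connEvent ends o t) +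
        (1 - p e) * RBRoot.rbSum (Function.update p e 0) ends s t w (connEvent ends b s)
          (connEvent ends o t) := by
  unfold RBRoot.rbSum
  rw [Finset.mul_sum, Finset.mul_sum, ← Finset.sum_add_distrib]
  exact Finset.sum_congr rfl fun A _ => term_pin_cross_b ends s t w hp hends o A

/-- **Affinity of the Rao–Blackwell sum, cross pair, in the weight of `{w, o}`.** -/
theorem rbSum_pin_cross_o {p : E → R} (hp : IsProbVec p) {o : V} (hends : ends e = s(w, o)) (b : V) :
    RBRoot.rbSum p ends s t w (connEvent ends b s) (connEvent ends o t) =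
      p e * RBRoot.rbSum (Function.update p e 1) ends s t w (connEvent ends b s) (connEvent ends o t) +
        (1 - p e) * RBRoot.rbSum (Function.update p e 0) ends s t w (connEvent ends b s)
          (connEvent ends o t) := by
  unfold RBRoot.rbSum
  rw [Finset.mul_sum, Finset.mul_sum, ← Finset.sum_add_distrib]
  exact Finset.sum_congr rfl fun A _ => term_pin_cross_o ends s t w hp hends b A

/-- Under `p[e ↦ 1]`, `e = {w, b}`: the cross sum at `w` collapses at `b` to `P(Q ∩ bL ∩ oH)`. -/
theorem rbSum_update_one_cross_b (p : E → R) (hp : IsProbVec p) {b : V} (hends : ends e = s(w, b))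
    (o : V) :
    RBRoot.rbSum (Function.update p e 1) ends s t w (connEvent ends b s) (connEvent ends o t) =
      prob (Function.update p e 1) ((connEvent ends s t)ᶜ ∩ connEvent ends b s ∩ connEvent ends o t) := by
  have hp1 : IsProbVec (Function.update p e 1) := hp.update e zero_le_one le_rfl
  rw [show RBRoot.rbSum (Function.update p e 1) ends s t w (connEvent ends b s) (connEvent ends o t) =
      RBRoot.rbSum (Function.update p e 1) ends s t b (connEvent ends b s) (connEvent ends o t) by
    unfold RBRoot.rbSum
    refine Finset.sum_congr rfl fun A _ => ?_
    rw [Set.inter_right_comm _ (clusterEvent ends w A), Set.inter_right_comm _ (clusterEvent ends w A),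
      RBRootEdge.prob_update_one_atom_eq p ends b w hends _ A,
      RBRootEdge.prob_update_one_atom_eq p ends b w hends _ A,
      RBRootEdge.prob_update_one_atom_eq p ends b w hends _ A,
      ← Set.inter_right_comm _ (clusterEvent ends b A), ← Set.inter_right_comm _ (clusterEvent ends b A)]]
  rw [RBRoot.connEvent_eq_clusterInEvent_left ends b s, RBRoot.rbSum_of_clusterInEvent ends hp1,
    ← RBRoot.connEvent_eq_clusterInEvent_left ends b s]

/-- Under `p[e ↦ 1]`, `e = {w, o}`: the cross sum at `w` collapses at `o` to `P(Q ∩ bL ∩ oH)`. -/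
theorem rbSum_update_one_cross_o (p : E → R) (hp : IsProbVec p) {o : V} (hends : ends e = s(w, o))
    (b : V) :
    RBRoot.rbSum (Function.update p e 1) ends s t w (connEvent ends b s) (connEvent ends o t) =
      prob (Function.update p e 1) ((connEvent ends s t)ᶜ ∩ connEvent ends b s ∩ connEvent ends o t) := by
  have hp1 : IsProbVec (Function.update p e 1) := hp.update e zero_le_one le_rfl
  rw [show RBRoot.rbSum (Function.update p e 1) ends s t w (connEvent ends b s) (connEvent ends o t) =
      RBRoot.rbSum (Function.update p e 1) ends s t o (connEvent ends b s) (connEvent ends o t) by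
    unfold RBRoot.rbSum
    refine Finset.sum_congr rfl fun A _ => ?_
    rw [Set.inter_right_comm _ (clusterEvent ends w A), Set.inter_right_comm _ (clusterEvent ends w A),
      RBRootEdge.prob_update_one_atom_eq p ends o w hends _ A,
      RBRootEdge.prob_update_one_atom_eq p ends o w hends _ A,
      RBRootEdge.prob_update_one_atom_eq p ends o w hends _ A,
      ← Set.inter_right_comm _ (clusterEvent ends o A), ← Set.inter_right_comm _ (clusterEvent ends o A)]]
  rw [RBRoot.rbSum_comm, RBRoot.connEvent_eq_clusterInEvent_left ends o t,
    RBRoot.rbSum_of_clusterInEvent ends hp1, ← RBRoot.connEvent_eq_clusterInEvent_left ends o t,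
    RBRoot.inter_inter_comm]

end CrossAffine

section CrossAux

variable {V : Type*} {E : Type*} [Fintype E] [DecidableEq E] [Fintype V] {R : Type*} [Field R]
  [LinearOrder R] [IsStrictOrderedRing R]

omit [Fintype V] [LinearOrder R] [IsStrictOrderedRing R] in
/-- The both-open law is the `G − w` law (both edges closed) with both edges forced open. -/
lemma prob_both_open_eq (p : E → R) {e₁ e₂ : E} (hne : e₁ ≠ e₂) (S : Set (Config E)) :
    prob (Function.update (Function.update p e₂ 1) e₁ 1) S =
      prob (Function.update (Function.update p e₂ 0) e₁ 0)
        {ω | Function.update (Function.update ω e₁ true) e₂ true ∈ S} := by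
  have e : Function.update (Function.update p e₂ 1) e₁ 1 =
      Function.update (Function.update (Function.update (Function.update p e₂ 0) e₁ 0) e₁ 1) e₂ 1 := by
    rw [Function.update_idem, Function.update_comm hne, Function.update_idem]
  rw [e, RBRootEdge.prob_update_one_eq, RBRootEdge.prob_update_one_eq]
  rfl

omit [Fintype V] [LinearOrder R] [IsStrictOrderedRing R] in
/-- The `G − w` law is supported on configurations with both marker edges closed. -/
lemma prob_both_closed_eq (p : E → R) {e₁ e₂ : E} (hne : e₁ ≠ e₂) (S : Set (Config E)) :
    prob (Function.update (Function.update p e₂ 0) e₁ 0) S =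
      prob (Function.update (Function.update p e₂ 0) e₁ 0) (S ∩ closedEdge e₁ ∩ closedEdge e₂) := by
  calc prob (Function.update (Function.update p e₂ 0) e₁ 0) S
      = prob (Function.update (Function.update p e₂ 0) e₁ 0) (S ∩ closedEdge e₁) :=
        (prob_update_zero_inter_closedEdge _ S e₁).symm
    _ = prob (Function.update (Function.update p e₂ 0) e₁ 0) (S ∩ closedEdge e₁ ∩ closedEdge e₂) := by
        rw [Function.update_comm hne.symm]
        exact (prob_update_zero_inter_closedEdge _ _ e₂).symm

/-- **The cleared cross mixture inequality** (the `r → 0` form `m/a + m′/d ≥ 1` of §32):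
with `0 ≤ A, D ≤ Z`, `0 ≤ P₁ ≤ Z`, `P₁ Z ≤ A D`, `A − P₁ ≤ M ≤ Z₁ ≤ Z − P₁`, `D − P₁ ≤ M′`,
`(1 − x)·AD/Z ≤ (xM + (1−x)A)(xM′ + (1−x)D)/(xZ₁ + (1−x)Z)`. -/
lemma mix_cross_var {x A D Z P₁ M M' Z₁ : R} (hx0 : 0 ≤ x) (hx1 : x ≤ 1) (hA0 : 0 ≤ A) (hAZ : A ≤ Z)
    (hD0 : 0 ≤ D) (hDZ : D ≤ Z) (hBHK : P₁ * Z ≤ A * D)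
    (hM : A - P₁ ≤ M) (hM0 : 0 ≤ M) (hMZ : M ≤ Z₁) (hM' : D - P₁ ≤ M') (hM'0 : 0 ≤ M')
    (hZ₁ : Z₁ ≤ Z - P₁) :
    (1 - x) * (A * D / Z) ≤ (x * M + (1 - x) * A) * (x * M' + (1 - x) * D) / (x * Z₁ + (1 - x) * Z) := by
  have hx1' : 0 ≤ 1 - x := sub_nonneg.2 hx1
  rcases eq_or_lt_of_le (hA0.trans hAZ) with hZ | hZ
  · have hA : A = 0 := le_antisymm (hZ ▸ hAZ) hA0
    rw [hA, zero_mul, zero_div, mul_zero]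
    exact div_nonneg (mul_nonneg (add_nonneg (mul_nonneg hx0 hM0) le_rfl)
      (add_nonneg (mul_nonneg hx0 hM'0) (mul_nonneg hx1' hD0)))
      (add_nonneg (mul_nonneg hx0 (hM0.trans hMZ)) (mul_nonneg hx1' hZ.le))
  rcases eq_or_lt_of_le (add_nonneg (mul_nonneg hx0 (hM0.trans hMZ)) (mul_nonneg hx1' hZ.le)) with hD' | hD'
  · -- the mixed denominator vanishes: `x = 1`, `Z₁ = 0`
    rw [← hD', div_zero]
    have hx : 1 - x = 0 := by
      by_contra h
      have : 0 < (1 - x) * Z := mul_pos (lt_of_le_of_ne hx1' (Ne.symm h)) hZ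
      linarith [mul_nonneg hx0 (hM0.trans hMZ)]
    rw [hx, zero_mul]
  · rw [← mul_div_assoc, div_le_div_iff₀ hZ hD']
    -- the key bound `P₁ Z (A + D) ≤ A D Z + A D P₁`
    have hbr : 0 ≤ Z * (A + D) - A * D := by nlinarith
    have h1 : P₁ * Z * (Z * (A + D) - A * D) ≤ A * D * (Z * (A + D) - A * D) :=
      mul_le_mul_of_nonneg_right hBHK hbr
    have h2 : A * D * (Z * (A + D) - A * D) ≤ A * D * (Z * Z) := by
      apply mul_le_mul_of_nonneg_left _ (mul_nonneg hA0 hD0)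
      nlinarith [mul_nonneg (sub_nonneg.2 hAZ) (sub_nonneg.2 hDZ)]
    have hkey : P₁ * Z * (A + D) ≤ A * D * Z + A * D * P₁ := by
      have : Z * (P₁ * Z * (A + D)) ≤ Z * (A * D * Z + A * D * P₁) := by nlinarith [h1, h2]
      exact le_of_mul_le_mul_left this hZ
    -- the bracket `Z(MD + AM′) − ADZ₁ ≥ ADZ + ADP₁ − P₁Z(A + D) ≥ 0`
    have hb1 : Z * (A - P₁) * D ≤ Z * M * D :=
      mul_le_mul_of_nonneg_right (mul_le_mul_of_nonneg_left hM hZ.le) hD0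
    have hb2 : Z * A * (D - P₁) ≤ Z * A * M' := mul_le_mul_of_nonneg_left hM' (mul_nonneg hZ.le hA0)
    have hb3 : A * D * Z₁ ≤ A * D * (Z - P₁) := mul_le_mul_of_nonneg_left hZ₁ (mul_nonneg hA0 hD0)
    have hbracket : 0 ≤ Z * (M * D + A * M') - A * D * Z₁ := by nlinarith [hb1, hb2, hb3, hkey]
    have hsq : 0 ≤ x * x * M * M' * Z :=
      mul_nonneg (mul_nonneg (mul_nonneg (mul_nonneg hx0 hx0) hM0) hM'0) hZ.le
    have hmix : 0 ≤ x * (1 - x) * (Z * (M * D + A * M') - A * D * Z₁) :=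
      mul_nonneg (mul_nonneg hx0 hx1') hbracket
    have key : (x * M + (1 - x) * A) * (x * M' + (1 - x) * D) * Z -
        (1 - x) * (A * D) * (x * Z₁ + (1 - x) * Z) =
        x * x * M * M' * Z + x * (1 - x) * (Z * (M * D + A * M') - A * D * Z₁) := by ring
    linarith [key, hsq, hmix]

end CrossAux

end RBTwoMarkers

end Summit.Ventures.PercRepro2
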